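import Mathlib
import Summits.NavierStokesRegularity.NavierStokesRegularity.Theorems.FilamentSkeletonRssClause13ProfileKernels

/-!
# Clause 13-J/13-R, brick n3 (KERNEL PACKAGES): all the facts `model_l2_estimate` asks of one kernel, for mother kernels and their dilates

Route `FilamentSkeletonRss`, ∃-side clause 13 (`Clause13RNearStraightL` stmt-NavierStokesRegularity-23612; typing-agnostic).  Book-keeping layer
between the generic Fourier facts (`…Clause13PartitionKernels` p698858, `…Clause13ProfileKernels` p708670) and the construction of the six-piece
kernel system: each lemma takes a kernel through DEFINING EQUATIONS (`∀ t, k t = …`) and returns, as one conjunction, every regularity /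
integrability / boundedness / transform / moment fact that `model_l2_estimate` consumes.
* `reMother_package` — `r = Re 𝓕⁻ψ` for a real even Schwartz `ψ` (with `r′, r″` from `derivCLM`): `C²`, seven integrable moments, two uniform bounds,
  `∫ r e^{izt} = ψ(−z/2π)`;
* `bandMother_package` — `α = Re 𝓕⁻ψ`, `β = Im 𝓕⁻ψ` for a real Schwartz `ψ`: `C¹`, moments, bounds, `α` even / `β` odd,
  `∫α e^{izt} + i∫β e^{izt} = ψ(−z/2π)`;
* `scaled_package` — from mother facts for `(r, r′, r″)` to the dilate `k(t) = μ⁻¹r(t/μ)` (`k′ = μ⁻²r′(·/μ)`, `k″ = μ⁻³r″(·/μ)`): the same facts plus the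
  nine moment identities (`‖k‖₁ = ‖r‖₁`, `‖t k‖₁ = μ‖u r‖₁`, `‖k′‖₁ = μ⁻¹‖r′‖₁`, …, transition-kernel moments) and `∫k e^{izt} = Φ(μz)`;
* `scaledBand_package` — the same for the pair `(a, b) = (μ⁻¹α(·/μ), μ⁻¹β(·/μ))`.
Lane ns-filament-19175-p1 g17; `--supports stmt-NavierStokesRegularity-23612 --as helper`.
HONEST FRAMING: bookkeeping for a HYPOTHETICAL filament skeleton's model operator on the NEGATIVE side of a MODEL route; nothing here bears on
Navier–Stokes regularity or blow-up.
-/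

noncomputable section

open MeasureTheory Real Complex Filter Set
open scoped FourierTransform ComplexConjugate Topology

namespace Summit.NavierStokesRegularity.NavierStokesRegularity.Theorems.MatchedKernel
set_option linter.dupNamespace false

/-! ## §1 Mother kernels from Schwartz profiles -/

/-- **Real even mother.**  `ψ ∈ 𝓢(ℝ,ℂ)` real and even, `φ = 𝓕⁻ψ`, `r = Re φ`, `r′ = Re φ′`, `r″ = Re φ″` (given through defining equations):
`C²` structure, the seven integrable moments, the bounds `|r| ≤ p₀₀(φ)`, `|u·r′(u)| ≤ p₁₀(φ′)`, and `∫ r e^{izt} = ψ(−z/(2π))`. [folklore] -/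
theorem reMother_package (ψ : SchwartzMap ℝ ℂ) (hre : ∀ v, conj (ψ v) = ψ v) (hev : ∀ v, ψ (-v) = ψ v) {r r' r'' : ℝ → ℝ}
    (er : ∀ u, r u = ((𝓕⁻ ψ : SchwartzMap ℝ ℂ) u).re) (er' : ∀ u, r' u = (SchwartzMap.derivCLM ℝ ℂ (𝓕⁻ ψ : SchwartzMap ℝ ℂ) u).re)
    (er'' : ∀ u, r'' u = (SchwartzMap.derivCLM ℝ ℂ (SchwartzMap.derivCLM ℝ ℂ (𝓕⁻ ψ : SchwartzMap ℝ ℂ)) u).re) :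
    (∀ u, HasDerivAt r (r' u) u) ∧ (∀ u, HasDerivAt r' (r'' u) u) ∧ Continuous r' ∧ Continuous r'' ∧
    Integrable r ∧ (Integrable fun u => u * r u) ∧ Integrable r' ∧ (Integrable fun u => u * r' u) ∧ (Integrable fun u => u ^ 2 * r' u) ∧
    (Integrable fun u => u * r'' u) ∧ (Integrable fun u => u ^ 2 * r'' u) ∧
    (∀ u, |r u| ≤ SchwartzMap.seminorm ℝ 0 0 (𝓕⁻ ψ : SchwartzMap ℝ ℂ)) ∧
    (∀ u, |u * r' u| ≤ SchwartzMap.seminorm ℝ 1 0 (SchwartzMap.derivCLM ℝ ℂ (𝓕⁻ ψ : SchwartzMap ℝ ℂ))) ∧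
    (∀ z : ℝ, ∫ t : ℝ, ((r t : ℝ) : ℂ) * cexp (I * z * t) = ψ (-z / (2 * π))) := by
  have hr : r = fun u => ((𝓕⁻ ψ : SchwartzMap ℝ ℂ) u).re := funext er
  have hr' : r' = fun u => (SchwartzMap.derivCLM ℝ ℂ (𝓕⁻ ψ : SchwartzMap ℝ ℂ) u).re := funext er'
  have hr'' : r'' = fun u => (SchwartzMap.derivCLM ℝ ℂ (SchwartzMap.derivCLM ℝ ℂ (𝓕⁻ ψ : SchwartzMap ℝ ℂ)) u).re := funext er''
  subst hr hr' hr''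
  set φ : SchwartzMap ℝ ℂ := 𝓕⁻ ψ with hφ
  set φ' : SchwartzMap ℝ ℂ := SchwartzMap.derivCLM ℝ ℂ φ with hφ'
  set φ'' : SchwartzMap ℝ ℂ := SchwartzMap.derivCLM ℝ ℂ φ' with hφ''
  refine ⟨hasDerivAt_reKernel φ, hasDerivAt_reKernel φ', continuous_reKernel φ', continuous_reKernel φ'', integrable_reKernel φ,
    integrable_mul_reKernel φ, integrable_reKernel φ', integrable_mul_reKernel φ', integrable_pow_mul_reKernel φ' 2, integrable_mul_reKernel φ'',
    integrable_pow_mul_reKernel φ'' 2, abs_reKernel_le φ, abs_mul_reKernel_le φ', fun z => ?_⟩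
  rw [hφ]
  exact unnormalisedTransform_reKernel ψ hre hev z

/-- **Real (one-sided) band mother.**  `ψ ∈ 𝓢(ℝ,ℂ)` real, `φ = 𝓕⁻ψ`, `α = Re φ`, `β = Im φ`, `α′ = Re φ′`, `β′ = Im φ′`: `C¹` structure, moments, bounds,
`α` even, `β` odd, and `∫ α e^{izt} + i∫ β e^{izt} = ψ(−z/(2π))`. [folklore] -/
theorem bandMother_package (ψ : SchwartzMap ℝ ℂ) (hre : ∀ v, conj (ψ v) = ψ v) {α α' β β' : ℝ → ℝ}
    (eα : ∀ u, α u = ((𝓕⁻ ψ : SchwartzMap ℝ ℂ) u).re) (eα' : ∀ u, α' u = (SchwartzMap.derivCLM ℝ ℂ (𝓕⁻ ψ : SchwartzMap ℝ ℂ) u).re)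
    (eβ : ∀ u, β u = ((𝓕⁻ ψ : SchwartzMap ℝ ℂ) u).im) (eβ' : ∀ u, β' u = (SchwartzMap.derivCLM ℝ ℂ (𝓕⁻ ψ : SchwartzMap ℝ ℂ) u).im) :
    (∀ u, HasDerivAt α (α' u) u) ∧ Continuous α' ∧ Integrable α ∧ Integrable α' ∧ (Integrable fun u => u * α u) ∧
    (Integrable fun u => u * α' u) ∧ (∀ u, |α u| ≤ SchwartzMap.seminorm ℝ 0 0 (𝓕⁻ ψ : SchwartzMap ℝ ℂ)) ∧ (∀ u, α (-u) = α u) ∧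
    (∀ u, HasDerivAt β (β' u) u) ∧ Continuous β' ∧ Integrable β ∧ Integrable β' ∧ (Integrable fun u => u * β u) ∧
    (Integrable fun u => u * β' u) ∧ (∀ u, |β u| ≤ SchwartzMap.seminorm ℝ 0 0 (𝓕⁻ ψ : SchwartzMap ℝ ℂ)) ∧ (∀ u, β (-u) = -β u) ∧
    (∀ z : ℝ, (∫ t : ℝ, ((α t : ℝ) : ℂ) * cexp (I * z * t)) + I * (∫ t : ℝ, ((β t : ℝ) : ℂ) * cexp (I * z * t)) = ψ (-z / (2 * π))) := by
  have hα : α = fun u => ((𝓕⁻ ψ : SchwartzMap ℝ ℂ) u).re := funext eα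
  have hα' : α' = fun u => (SchwartzMap.derivCLM ℝ ℂ (𝓕⁻ ψ : SchwartzMap ℝ ℂ) u).re := funext eα'
  have hβ : β = fun u => ((𝓕⁻ ψ : SchwartzMap ℝ ℂ) u).im := funext eβ
  have hβ' : β' = fun u => (SchwartzMap.derivCLM ℝ ℂ (𝓕⁻ ψ : SchwartzMap ℝ ℂ) u).im := funext eβ'
  subst hα hα' hβ hβ'
  set φ : SchwartzMap ℝ ℂ := 𝓕⁻ ψ with hφ
  set φ' : SchwartzMap ℝ ℂ := SchwartzMap.derivCLM ℝ ℂ φ with hφ'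
  refine ⟨hasDerivAt_reKernel φ, continuous_reKernel φ', integrable_reKernel φ, integrable_reKernel φ', integrable_mul_reKernel φ,
    integrable_mul_reKernel φ', abs_reKernel_le φ, fun u => ?_, hasDerivAt_imKernel φ, continuous_imKernel φ',
    by simpa using integrable_pow_mul_imKernel φ 0, by simpa using integrable_pow_mul_imKernel φ' 0,
    by simpa using integrable_pow_mul_imKernel φ 1, by simpa using integrable_pow_mul_imKernel φ' 1, abs_imKernel_le φ, fun u => ?_,
    fun z => ?_⟩
  · rw [hφ]; exact reKernel_even ψ hre u
  · rw [hφ]; exact imKernel_odd ψ hre u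
  · rw [hφ]; exact unnormalisedTransform_reIm ψ z

/-! ## §2 Dilates -/

/-- **Scaled package.**  Mother facts for `(r, r′, r″)` (as produced by `reMother_package`, with bounds `B₀, B₁` and profile `Φ`) and `μ > 0`;
`k(t) = μ⁻¹r(t/μ)`, `k′(t) = μ⁻¹(μ⁻¹r′(t/μ))`, `k″(t) = μ⁻¹(μ⁻¹(μ⁻¹r″(t/μ)))` through defining equations.  Conclusion: everything `model_l2_estimate`
needs of a near-type kernel and of its transition kernel `t·k′ + k`, with the moments expressed through the mother moments. [folklore] -/
theorem scaled_package {r r' r'' : ℝ → ℝ} (hr : ∀ u, HasDerivAt r (r' u) u) (hr' : ∀ u, HasDerivAt r' (r'' u) u) (hr'c : Continuous r')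
    (hr''c : Continuous r'') (h0 : Integrable r) (h1 : Integrable fun u => u * r u) (hd0 : Integrable r') (hd1 : Integrable fun u => u * r' u)
    (hd2 : Integrable fun u => u ^ 2 * r' u) (hdd1 : Integrable fun u => u * r'' u) (hdd2 : Integrable fun u => u ^ 2 * r'' u)
    {B₀ B₁ : ℝ} (hB₀ : ∀ u, |r u| ≤ B₀) (hB₁ : ∀ u, |u * r' u| ≤ B₁) {Φ : ℝ → ℂ}
    (hΦ : ∀ z : ℝ, ∫ t : ℝ, ((r t : ℝ) : ℂ) * cexp (I * z * t) = Φ z) {μ : ℝ} (hμ : 0 < μ) {k k' k'' : ℝ → ℝ}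
    (ek : ∀ t, k t = μ⁻¹ * r (t / μ)) (ek' : ∀ t, k' t = μ⁻¹ * (μ⁻¹ * r' (t / μ))) (ek'' : ∀ t, k'' t = μ⁻¹ * (μ⁻¹ * (μ⁻¹ * r'' (t / μ)))) :
    (∀ t, HasDerivAt k (k' t) t) ∧ (∀ t, HasDerivAt k' (k'' t) t) ∧ Continuous k' ∧ Continuous k'' ∧
    Integrable k ∧ Integrable k' ∧ (Integrable fun t => t * k t) ∧ (Integrable fun t => t * k' t) ∧ (Integrable fun t => t ^ 2 * k' t) ∧
    (Integrable fun t => t * k'' t) ∧ (Integrable fun t => t ^ 2 * k'' t) ∧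
    (∀ t, |k t| ≤ μ⁻¹ * B₀) ∧ (∀ t, |t * k' t + k t| ≤ μ⁻¹ * (B₁ + B₀)) ∧
    (∀ z : ℝ, ∫ t : ℝ, ((k t : ℝ) : ℂ) * cexp (I * z * t) = Φ (μ * z)) ∧
    (∫ t, |k t| = ∫ u, |r u|) ∧ (∫ t, |t| * |k t| = μ * ∫ u, |u| * |r u|) ∧ (∫ t, |k' t| = μ⁻¹ * ∫ u, |r' u|) ∧
    (∫ t, |t| * |k' t| = ∫ u, |u| * |r' u|) ∧ (∫ t, t ^ 2 * |k' t| = μ * ∫ u, u ^ 2 * |r' u|) ∧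
    (∫ t, |t * k' t + k t| = ∫ u, |u * r' u + r u|) ∧ (∫ t, |t| * |t * k' t + k t| = μ * ∫ u, |u| * |u * r' u + r u|) ∧
    (∫ t, |2 * k' t + t * k'' t| = μ⁻¹ * ∫ u, |2 * r' u + u * r'' u|) ∧ (∫ t, |t| * |2 * k' t + t * k'' t| = ∫ u, |u| * |2 * r' u + u * r'' u|) := by
  have hk : k = fun t => μ⁻¹ * r (t / μ) := funext ek
  have hk' : k' = fun t => μ⁻¹ * (μ⁻¹ * r' (t / μ)) := funext ek'
  have hk'' : k'' = fun t => μ⁻¹ * (μ⁻¹ * (μ⁻¹ * r'' (t / μ))) := funext ek''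
  subst hk hk' hk''
  have hμ0 : μ ≠ 0 := hμ.ne'
  -- the transition kernel and its derivative are themselves dilates
  have eT : ∀ t : ℝ, t * (μ⁻¹ * (μ⁻¹ * r' (t / μ))) + μ⁻¹ * r (t / μ) = μ⁻¹ * (t / μ * r' (t / μ) + r (t / μ)) := fun t => by
    field_simp
  have eT' : ∀ t : ℝ, 2 * (μ⁻¹ * (μ⁻¹ * r' (t / μ))) + t * (μ⁻¹ * (μ⁻¹ * (μ⁻¹ * r'' (t / μ))))
      = μ⁻¹ * (μ⁻¹ * (2 * r' (t / μ) + t / μ * r'' (t / μ))) := fun t => by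
    field_simp
  refine ⟨fun t => hasDerivAt_scaledKernel hr μ t, fun t => ?_, ?_, ?_, integrable_scaledKernel h0 hμ, ?_, integrable_mul_scaledKernel h1 hμ,
    integrable_mul_scaledKernelDeriv hd1 hμ, integrable_sq_mul_scaledKernelDeriv hd2 hμ, ?_, ?_, fun t => abs_scaledKernel_le hB₀ hμ t, fun t => ?_,
    fun z => ?_, integral_abs_scaledKernel r hμ, integral_abs_mul_abs_scaledKernel r hμ, integral_abs_deriv_scaledKernel r' hμ,
    integral_abs_mul_abs_deriv_scaledKernel r' hμ, integral_sq_mul_abs_deriv_scaledKernel r' hμ, ?_, ?_, ?_, ?_⟩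
  · -- `k′` is the dilate of `μ⁻¹ r′`
    have h := hasDerivAt_scaledKernel (k := fun u => μ⁻¹ * r' u) (k' := fun u => μ⁻¹ * r'' u) (fun u => (hr' u).const_mul μ⁻¹) μ t
    exact h
  · exact continuous_const.mul (continuous_const.mul (hr'c.comp (continuous_id.div_const μ)))
  · exact continuous_const.mul (continuous_const.mul (continuous_const.mul (hr''c.comp (continuous_id.div_const μ))))
  · exact (integrable_scaledKernel hd0 hμ).const_mul μ⁻¹
  · have h := (integrable_mul_scaledKernelDeriv hdd1 hμ).const_mul μ⁻¹
    refine h.congr (ae_of_all _ fun t => ?_)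
    show μ⁻¹ * (t * (μ⁻¹ * (μ⁻¹ * r'' (t / μ)))) = t * (μ⁻¹ * (μ⁻¹ * (μ⁻¹ * r'' (t / μ))))
    ring
  · have h := (integrable_sq_mul_scaledKernelDeriv hdd2 hμ).const_mul μ⁻¹
    refine h.congr (ae_of_all _ fun t => ?_)
    show μ⁻¹ * (t ^ 2 * (μ⁻¹ * (μ⁻¹ * r'' (t / μ)))) = t ^ 2 * (μ⁻¹ * (μ⁻¹ * (μ⁻¹ * r'' (t / μ))))
    ring
  · rw [eT t, abs_mul, abs_of_pos (inv_pos.2 hμ)]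
    refine mul_le_mul_of_nonneg_left ((abs_add_le _ _).trans (add_le_add (hB₁ _) (hB₀ _))) (inv_pos.2 hμ).le
  · rw [unnormalisedTransform_scaledKernel r hμ z, ← hΦ (μ * z)]
    refine integral_congr_ae (ae_of_all _ fun u => ?_)
    push_cast; ring_nf
  · simp_rw [eT]
    exact integral_abs_scaledKernel (fun u => u * r' u + r u) hμ
  · simp_rw [eT]
    exact integral_abs_mul_abs_scaledKernel (fun u => u * r' u + r u) hμ
  · simp_rw [eT']
    exact integral_abs_deriv_scaledKernel (fun u => 2 * r' u + u * r'' u) hμ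
  · simp_rw [eT']
    exact integral_abs_mul_abs_deriv_scaledKernel (fun u => 2 * r' u + u * r'' u) hμ

/-- **Scaled band package.**  Band mother facts for `(α, α′, β, β′)` (from `bandMother_package`, bounds `Bα, Bβ`, profile `Φ`) and `μ > 0`;
`a = μ⁻¹α(·/μ)`, `a′ = μ⁻²α′(·/μ)`, `b, b′` likewise (defining equations).  Conclusion: everything `model_l2_estimate` needs of the band pair, with
the moments through the mother moments and `∫a e^{izt} + i∫ b e^{izt} = Φ(μz)`. [folklore] -/
theorem scaledBand_package {α α' β β' : ℝ → ℝ} (hα : ∀ u, HasDerivAt α (α' u) u) (hα'c : Continuous α') (hα0 : Integrable α)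
    (hαd0 : Integrable α') (hα1 : Integrable fun u => u * α u) (hαd1 : Integrable fun u => u * α' u) {Bα : ℝ} (hBα : ∀ u, |α u| ≤ Bα)
    (hαev : ∀ u, α (-u) = α u)
    (hβ : ∀ u, HasDerivAt β (β' u) u) (hβ'c : Continuous β') (hβ0 : Integrable β) (hβd0 : Integrable β') (hβ1 : Integrable fun u => u * β u)
    (hβd1 : Integrable fun u => u * β' u) {Bβ : ℝ} (hBβ : ∀ u, |β u| ≤ Bβ) (hβodd : ∀ u, β (-u) = -β u) {Φ : ℝ → ℂ}
    (hΦ : ∀ z : ℝ, (∫ t : ℝ, ((α t : ℝ) : ℂ) * cexp (I * z * t)) + I * (∫ t : ℝ, ((β t : ℝ) : ℂ) * cexp (I * z * t)) = Φ z)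
    {μ : ℝ} (hμ : 0 < μ) {a a' b b' : ℝ → ℝ} (ea : ∀ t, a t = μ⁻¹ * α (t / μ)) (ea' : ∀ t, a' t = μ⁻¹ * (μ⁻¹ * α' (t / μ)))
    (eb : ∀ t, b t = μ⁻¹ * β (t / μ)) (eb' : ∀ t, b' t = μ⁻¹ * (μ⁻¹ * β' (t / μ))) :
    (∀ t, HasDerivAt a (a' t) t) ∧ Continuous a' ∧ Integrable a ∧ Integrable a' ∧ (Integrable fun t => t * a t) ∧
    (Integrable fun t => t * a' t) ∧ (∀ t, |a t| ≤ μ⁻¹ * Bα) ∧ (∀ t, a (-t) = a t) ∧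
    (∀ t, HasDerivAt b (b' t) t) ∧ Continuous b' ∧ Integrable b ∧ Integrable b' ∧ (Integrable fun t => t * b t) ∧
    (Integrable fun t => t * b' t) ∧ (∀ t, |b t| ≤ μ⁻¹ * Bβ) ∧ (∀ t, b (-t) = -b t) ∧
    (∀ z : ℝ, (∫ t : ℝ, ((a t : ℝ) : ℂ) * cexp (I * z * t)) + I * (∫ t : ℝ, ((b t : ℝ) : ℂ) * cexp (I * z * t)) = Φ (μ * z)) ∧
    (∫ t, |a t| = ∫ u, |α u|) ∧ (∫ t, |t| * |a t| = μ * ∫ u, |u| * |α u|) ∧ (∫ t, |t| * |a' t| = ∫ u, |u| * |α' u|) ∧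
    (∫ t, |b t| = ∫ u, |β u|) ∧ (∫ t, |t| * |b t| = μ * ∫ u, |u| * |β u|) ∧ (∫ t, |t| * |b' t| = ∫ u, |u| * |β' u|) := by
  have ha : a = fun t => μ⁻¹ * α (t / μ) := funext ea
  have ha' : a' = fun t => μ⁻¹ * (μ⁻¹ * α' (t / μ)) := funext ea'
  have hb : b = fun t => μ⁻¹ * β (t / μ) := funext eb
  have hb' : b' = fun t => μ⁻¹ * (μ⁻¹ * β' (t / μ)) := funext eb'
  subst ha ha' hb hb'
  refine ⟨fun t => hasDerivAt_scaledKernel hα μ t, continuous_const.mul (continuous_const.mul (hα'c.comp (continuous_id.div_const μ))),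
    integrable_scaledKernel hα0 hμ, (integrable_scaledKernel hαd0 hμ).const_mul μ⁻¹, integrable_mul_scaledKernel hα1 hμ,
    integrable_mul_scaledKernelDeriv hαd1 hμ, fun t => abs_scaledKernel_le hBα hμ t, fun t => ?_,
    fun t => hasDerivAt_scaledKernel hβ μ t, continuous_const.mul (continuous_const.mul (hβ'c.comp (continuous_id.div_const μ))),
    integrable_scaledKernel hβ0 hμ, (integrable_scaledKernel hβd0 hμ).const_mul μ⁻¹, integrable_mul_scaledKernel hβ1 hμ,
    integrable_mul_scaledKernelDeriv hβd1 hμ, fun t => abs_scaledKernel_le hBβ hμ t, fun t => ?_, fun z => ?_,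
    integral_abs_scaledKernel α hμ, integral_abs_mul_abs_scaledKernel α hμ, integral_abs_mul_abs_deriv_scaledKernel α' hμ,
    integral_abs_scaledKernel β hμ, integral_abs_mul_abs_scaledKernel β hμ, integral_abs_mul_abs_deriv_scaledKernel β' hμ⟩
  · show μ⁻¹ * α (-t / μ) = μ⁻¹ * α (t / μ)
    rw [neg_div, hαev]
  · show μ⁻¹ * β (-t / μ) = -(μ⁻¹ * β (t / μ))
    rw [neg_div, hβodd]; ring
  · rw [unnormalisedTransform_scaledKernel α hμ z, unnormalisedTransform_scaledKernel β hμ z, ← hΦ (μ * z)]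
    congr 1
    · refine integral_congr_ae (ae_of_all _ fun u => ?_); push_cast; ring_nf
    · congr 1
      refine integral_congr_ae (ae_of_all _ fun u => ?_); push_cast; ring_nf

end Summit.NavierStokesRegularity.NavierStokesRegularity.Theorems.MatchedKernel

end
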